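import Summits.QuantumFields.BalabanUV.T4Continuum.Support.ShellMeasureRootCompositionHistoriesEnd
import Summits.QuantumFields.BalabanUV.T4Continuum.Support.ShellMeasureWilsonLedger

/-!
# `T4Continuum.ShellMeasureRootCompositionHistoriesLevelZero` — file 3 of the history-indexed (R)+[dict] push: THE WALL
# OF THE HISTORIES LEDGER IS INHABITED AT LEVEL 0 — (M1)₀ for the `SU(2)` Gibbs law WITH THE CUBE'S OWN INDICATOR KEPT
# (`χ_θ(u_□)·e^{−βS_W} dU`) from row S2's exterior form of row S1 at co-test threshold `σ := θ` (NO mass ratio, NO window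
# removal, NO auxiliary `σ`); row S19's stripped (M1)₀ as a COROLLARY under weaker numerics; the cube partition as an
# instance of the histories data (= row S17's term data, realized law `χ_□·μ`); the level-0 histories ledger
# (cell `pub-balaban`, sub-cell `t4`, spine estimate NE7c (node U5b); NE7c ROUND-2 crew `t4-ne7c-formalise-*`, unit
# `b2b-balaban-t4-ne7c-formalise-leaf-05` gen 2; OFFERED row (journal l.7065), file 3; ADDITIVE — imports file 2
# `ShellMeasureRootCompositionHistoriesEnd` (p210501) and row S19's `ShellMeasureWilsonLedger` (p209189) only;
# 0 `def … : Prop`, 0 sorry, 0 cite)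

HONEST FRAMING.  Finite four-torus programme, rung (B)+1 only — NOT infinite volume, NOT a mass gap, NOT the Clay
problem, NOT summit progress.  NE7c = `T4IndicatorShell.ShellWeightBound` is NOT PRINTED in [Balaban 1983–89] and NOT
PROVED; «NE7c ⇐ the named binders» (trigger c3); a ONE-run LEVEL-0 statement is NOT NE7c (two runs, live window, rate
untouched); (M1) at live levels for Bałaban's effective measures is NOT PRINTED (GAPS G-ne7cp1-1), asserted by nobody.
Files 1–2 reduced END-I, for history-indexed term families, to (M1) per slot FOR THE `s`-SMALL PARTIAL LAW (own indicator
kept).  At level 0 with the common Gibbs factor the partial law of a cube RESUMS to `χ_θ(u_□)·μ` (§3, row S17's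
`sum_regionDensity_mem`), and (M1)₀ for THAT law is row S2's `ShellMeasureWilsonExterior.slotAntiConcentration_wilson_su2_exterior`
read at `σ := θ` — the box test IS the own indicator when the classifier plaquettes are the box (`P_u = boxPlaqs`, B14
(2.17) TYPE: the box is `□∼`; `wilsonU_lt_iff`), the exterior Wilson factor riding blind (row S19's device).  Since
`χ·μ ≤ μ` on `univ` and `= μ` on the shell, KEPT ⇒ STRIPPED (§1): row S19's §1∕§2 follow WITHOUT `σ`, `θ ≤ σ`, (SM)_σ, the
reach condition asked at `θ` (§2∕§4).  [folklore] compositions of tree theorems BY NAME; nothing printed is asserted.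
HONEST DEPENDENCY (cell): continuum YM on T⁴ ⇐ BetaPertH ∧ nine spine estimates (0/9 proved); BetaPertH ⇐ (D1) ∧ (D4) ∧
CAP+tail; G-an2-4 gates asym, D1 and NE2/3/4.

WHAT IS PROVED.  §1 `slotAntiConcentration_of_kept` ((M1) for `χ_θ(u)·μ` ⇒ (M1) for `μ`, same constant).  §2
`slotAntiConcentration_wilson_su2_gibbs_kept` ((M1)₀ for `(fieldMeasure P j SU2).withDensity (χ_θ(wilsonU P_u)·
e^{−βΣ_{P_ext ∪ P_w}})`, row S1's constant `2(n + β·#P_w·8S(8+32S))/(1−δ)`, under row S1's geometry, `↑P_u = boxPlaqs`,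
`β ≥ 0`, `0 < θ`, reach `(d−1)·m·θ ≤ 2S/π`, `0 ≤ δ < 1`, `0 ≤ ρ ≤ (1−δ)/2`, (SM)₀, `P_ext` avoiding `Λ`, disjoint from
`P_w`); `slotAntiConcentration_wilson_su2_gibbs'` (row S19's `…_gibbs` conclusion WITHOUT its `σ`-hypotheses).  §3 the cube
partition as histories over any finite measure space: `largeLaw C μ u θ O = (∏_{s∈C∖O} ζ_θ(u_s))·μ`, `histLaw_largeLaw`
(`= regionDensity_O·μ`), **`partialLaw_cubes`** (`partialLaw C.powerset (largeLaw C μ u θ) id u θ s = χ_θ(u_s)·μ`),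
`histWeight_largeLaw`∕`histShell_largeLaw`∕`histPiece_largeLaw` (the histories term data ARE row S17's — one term family,
two admissible realized laws: S17's `μ`, files 1–2's `χ_s·μ`).  §4 `levelLedger_histories_wilson_su2_levelZero`: file 2's
`levelLedger_histories` at level 0 for the cube partition of ONE lattice with the Gibbs weight, (M1)₀ per cube DISCHARGED
by §2 (kept form, uniform `D 0`); displayed: run B's measurable tested variables, per-cube a.e. closeness under the Gibbs
law (node U1b at level 0, DV-6), numerics, `D_□ ≤ D 0` — row S19 §2's list MINUS `σ`.
WHAT THIS DOES NOT DO.  One lattice, constant in `K`∕`t` (T-NE7c-6: a cutoff-indexed family is hosted by files 1–2's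
abstract `Ω K`, not instantiated here; the source tilt is row S19 file 2's device); no live level (END-II's laws vs
partial laws = the supplier rows' business); no window∕count (S9), no rate (U1b); NE7c NOT proved; 0/9 spine.
-/


noncomputable section

open Set Function MeasureTheory Finset

namespace Summit.QuantumFields.BalabanUV.T4Continuum.ShellMeasureRootCompositionHistoriesLevelZero

open scoped ENNReal
open Literature.MathematicalPhysics.QuantumFieldTheory.Balaban1983to89
open T4IndicatorShell (smallInd largeInd smallInd_nonneg smallInd_le_one largeInd_nonneg largeInd_le_one)
open T4ShellMeasure (SlotAntiConcentration)
open T4ShellMeasureLevels (LevelLedger)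
open T4CubeChartGnomonic (SU2)
open T4AxialGaugeFixing (combBonds)
open T4AxialGaugeSmallField (boxPlaqs boxBonds)
open ShellMeasureWilsonRealizedSU2 (wilsonU measurable_wilsonU measurable_wilsonSum wilsonSum_nonneg)
open ShellMeasureWilsonGaugeInvariant (boxTest giF)
open ShellMeasureWilsonStraddle (wilsonU_lt_iff plaqSmallOn_anti)
open ShellMeasureWilsonExterior (slotAntiConcentration_wilson_su2_exterior gaugeInvariant_wilsonWeight
  wilsonSum_updateFinset_of_avoids)
open ShellMeasureWilsonLevelZero (wilsonWeight_mul_eq_union)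
open ShellMeasureRootCompositionPush (measurable_smallInd measurable_largeInd)
open ShellMeasureRootCompositionPushCubes (regionDensity regionWeight regionShell regionPiece regionDensity_nonneg
  sum_regionDensity_mem measurable_regionDensity)
open ShellMeasureRootCompositionHistories (smallProd smallProd_nonneg histWeight histShell histPiece histLaw partialLaw
  measurableSet_shell measurable_smallProd)
open ShellMeasureRootCompositionHistoriesEnd (levelLedger_histories)

/-! ## §1 Kept implies stripped -/

section Kept

variable {Ω : Type*} [MeasurableSpace Ω]

/-- **(M1) FOR THE OWN-INDICATOR-KEPT LAW IMPLIES (M1) FOR THE STRIPPED LAW** (same constant): the threshold shell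
`{θ(1−ρ) ≤ u < θ}` lies below `θ`, where `χ_θ(u) = 1`, and `(χ_θ(u)·μ)(univ) ≤ μ(univ)`. [folklore] -/
theorem slotAntiConcentration_of_kept (μ : Measure Ω) {u : Ω → ℝ} (hu : Measurable u) {θ ρ D : ℝ}
    (h : SlotAntiConcentration (μ.withDensity fun ω => ENNReal.ofReal (smallInd (u ω) θ)) u θ ρ D) :
    SlotAntiConcentration μ u θ ρ D := by
  unfold T4ShellMeasure.SlotAntiConcentration at h ⊢
  have hE : MeasurableSet {x | θ * (1 - ρ) ≤ u x ∧ u x < θ} := measurableSet_shell hu _ _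
  have h1 : (μ.withDensity fun ω => ENNReal.ofReal (smallInd (u ω) θ)) {x | θ * (1 - ρ) ≤ u x ∧ u x < θ} =
      μ {x | θ * (1 - ρ) ≤ u x ∧ u x < θ} := by
    rw [withDensity_apply _ hE, ← setLIntegral_one]
    refine setLIntegral_congr_fun hE fun ω hω => ?_
    rw [T4IndicatorShell.smallInd, if_pos hω.2, ENNReal.ofReal_one]
  have h2 : (μ.withDensity fun ω => ENNReal.ofReal (smallInd (u ω) θ)) Set.univ ≤ μ Set.univ := by
    rw [withDensity_apply _ MeasurableSet.univ, Measure.restrict_univ, ← lintegral_one]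
    exact lintegral_mono fun ω => ENNReal.ofReal_le_one.2 (smallInd_le_one _ _)
  rw [h1] at h
  exact h.trans (mul_le_mul_right h2 _)

end Kept

/-! ## §2 (M1)₀ for the Gibbs law with the cube's own indicator KEPT — row S2's exterior form at `σ := θ` -/

section Gibbs

variable {P : Params} {j : ℕ} [DecidableEq (PBond P j)] [DecidableEq (Plaq P j)]

/-- **(M1)₀, OWN INDICATOR KEPT, NO AUXILIARY THRESHOLD.**  Row S1's data (non-wrapping box of side `≤ m`, chart bonds
`Λ` = box bonds off the axial comb, `n = 3·#Λ` coordinates, `0 < S ≤ 1/8`, `3S² < π²`, `P_w`, `β ≥ 0`, `θ > 0`,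
`0 ≤ δ < 1`, `0 ≤ ρ ≤ (1−δ)/2`, (SM)₀), classifier plaquettes = the box plaquettes (`P_u ⊆ box ⊆ P_u`), the reach
condition AT `θ` (`(d−1)·m·θ ≤ 2S/π`), `P_ext` avoiding `Λ`, disjoint from `P_w`.  CONCLUSION: (M1)₀ for
`(fieldMeasure P j SU2).withDensity (χ_θ(wilsonU P_u U) · e^{−β Σ_{p∈P_ext ∪ P_w}(1 − reTr U(∂p))})`, row S1's constant.
Proof: `slotAntiConcentration_wilson_su2_exterior` at `σ := θ` with the blind factor `e^{−βΣ_{P_ext}}`; its density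
`G·giF θ` IS the displayed one (`wilsonU_lt_iff`: the box test at `θ` = the own indicator). [folklore] -/
theorem slotAntiConcentration_wilson_su2_gibbs_kept
    {lo hi : Fin P.d → ℤ} {m : ℕ} (hN : ∀ κ, hi κ - lo κ < P.sitesPerDir j) (hm : ∀ κ, hi κ ≤ lo κ + m)
    (Λ : Finset (PBond P j)) (hΛbox : ∀ b ∈ Λ, b ∈ boxBonds lo hi) (hΛcomb : Disjoint Λ (combBonds lo hi))
    (hcov : ∀ b ∈ boxBonds lo hi, b ∉ Λ → b ∈ (combBonds lo hi : Finset (PBond P j))) {n : ℕ} (e : ↥Λ × Fin 3 ≃ Fin n)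
    {S : ℝ} (hS : 0 < S) (hS8 : S ≤ 1 / 8) (hSπ : 3 * S ^ 2 < Real.pi ^ 2) {Pu : Finset (Plaq P j)} (hPu : Pu.Nonempty)
    (hPubox : ∀ p ∈ Pu, p ∈ boxPlaqs lo hi) (hboxPu : boxPlaqs lo hi ⊆ (↑Pu : Set (Plaq P j)))
    (Pw Pext : Finset (Plaq P j)) {β θ δ ρ : ℝ} (hβ : 0 ≤ β) (hθ : 0 < θ)
    (hrad : ((P.d - 1 : ℕ) : ℝ) * m * θ ≤ 2 * S / Real.pi) (hδ0 : 0 ≤ δ) (hδ1 : δ < 1) (hρ0 : 0 ≤ ρ)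
    (hρ : ρ ≤ (1 - δ) / 2) (hSM : 4 * (8 * S) ^ 2 * Real.exp (2 * (8 * S)) ≤ δ * θ)
    (hPext : ∀ p ∈ Pext, (⟨p.src, p.μ⟩ : PBond P j) ∉ Λ ∧ (⟨p.src.shift p.μ, p.ν⟩ : PBond P j) ∉ Λ ∧
      (⟨p.src.shift p.ν, p.μ⟩ : PBond P j) ∉ Λ ∧ (⟨p.src, p.ν⟩ : PBond P j) ∉ Λ) (hdisj : Disjoint Pext Pw) :
    SlotAntiConcentration
      ((fieldMeasure P j SU2).withDensity fun U => ENNReal.ofReal (smallInd (wilsonU hPu U) θ) *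
        ENNReal.ofReal (Real.exp (-(β * ∑ p ∈ Pext ∪ Pw, (1 - reTr (GaugeField.plaqHol U p))))))
      (wilsonU hPu) θ ρ (2 * ((n : ℝ) + β * ∑ _p ∈ Pw, (8 * S) * (8 + 4 * (8 * S))) / (1 - δ)) := by
  -- the blind exterior Wilson factor (as in row S19)
  set Gx : GaugeField P j SU2 → ℝ≥0∞ := fun U =>
    ENNReal.ofReal (Real.exp (-(β * ∑ p ∈ Pext, (1 - reTr (GaugeField.plaqHol U p))))) with hGx
  have hGm : Measurable Gx :=
    ENNReal.measurable_ofReal.comp (Real.measurable_exp.comp (measurable_const.mul (measurable_wilsonSum Pext)).neg)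
  have hGi : GaugeField.GaugeInvariant Gx := gaugeInvariant_wilsonWeight β Pext
  have hGb : ∀ U y, Gx (updateFinset U Λ y) = Gx U := fun U y => by
    simp only [hGx, wilsonSum_updateFinset_of_avoids Λ hPext]
  have hG1 : ∀ U, Gx U ≤ 1 := fun U => by
    rw [hGx, ENNReal.ofReal_le_one, Real.exp_le_one_iff, neg_nonpos]
    exact mul_nonneg hβ (wilsonSum_nonneg Pext U)
  -- (M1)₀ for the box-windowed law AT THRESHOLD θ with the blind factor (row S2's exterior form of row S1)
  have h' := slotAntiConcentration_wilson_su2_exterior hN hm Λ hΛbox hΛcomb hcov e hS hS8 hSπ hθ hrad hPu hPubox Pw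
    hβ hθ hδ0 hδ1 hρ0 hρ hSM hSM hGm hGi hGb hG1
  -- its density IS the displayed one
  have hsub : (↑Pu : Set (Plaq P j)) ⊆ boxPlaqs lo hi := fun p hp => hPubox p hp
  have hF : (fun U => Gx U * giF lo hi θ β Pw U) = fun U => ENNReal.ofReal (smallInd (wilsonU hPu U) θ) *
      ENNReal.ofReal (Real.exp (-(β * ∑ p ∈ Pext ∪ Pw, (1 - reTr (GaugeField.plaqHol U p))))) := by
    funext U
    rw [hGx, giF, mul_left_comm, wilsonWeight_mul_eq_union hdisj]
    congr 1
    by_cases hU : wilsonU hPu U < θ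
    · rw [indicator_of_mem (show U ∈ boxTest lo hi θ from plaqSmallOn_anti hboxPu ((wilsonU_lt_iff hPu).1 hU)),
        Pi.one_apply, T4IndicatorShell.smallInd, if_pos hU, ENNReal.ofReal_one]
    · have hU' : U ∉ boxTest lo hi θ := fun hmem => hU ((wilsonU_lt_iff hPu).2 (plaqSmallOn_anti hsub hmem))
      rw [indicator_of_notMem hU', T4IndicatorShell.smallInd, if_neg hU, ENNReal.ofReal_zero]
  rw [hF] at h'
  exact h'

/-- **ROW S19's STRIPPED (M1)₀ AS A COROLLARY, WITHOUT `σ`**: (M1)₀ for the un-windowed law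
`e^{−β Σ_{p∈P_ext ∪ P_w}} dU` and `wilsonU P_u` under §2's hypotheses (the reach condition at `θ`; no `θ ≤ σ`, no
(SM)_σ) — `slotAntiConcentration_of_kept` ∘ `…_gibbs_kept`. [folklore] -/
theorem slotAntiConcentration_wilson_su2_gibbs'
    {lo hi : Fin P.d → ℤ} {m : ℕ} (hN : ∀ κ, hi κ - lo κ < P.sitesPerDir j) (hm : ∀ κ, hi κ ≤ lo κ + m)
    (Λ : Finset (PBond P j)) (hΛbox : ∀ b ∈ Λ, b ∈ boxBonds lo hi) (hΛcomb : Disjoint Λ (combBonds lo hi))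
    (hcov : ∀ b ∈ boxBonds lo hi, b ∉ Λ → b ∈ (combBonds lo hi : Finset (PBond P j))) {n : ℕ} (e : ↥Λ × Fin 3 ≃ Fin n)
    {S : ℝ} (hS : 0 < S) (hS8 : S ≤ 1 / 8) (hSπ : 3 * S ^ 2 < Real.pi ^ 2) {Pu : Finset (Plaq P j)} (hPu : Pu.Nonempty)
    (hPubox : ∀ p ∈ Pu, p ∈ boxPlaqs lo hi) (hboxPu : boxPlaqs lo hi ⊆ (↑Pu : Set (Plaq P j)))
    (Pw Pext : Finset (Plaq P j)) {β θ δ ρ : ℝ} (hβ : 0 ≤ β) (hθ : 0 < θ)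
    (hrad : ((P.d - 1 : ℕ) : ℝ) * m * θ ≤ 2 * S / Real.pi) (hδ0 : 0 ≤ δ) (hδ1 : δ < 1) (hρ0 : 0 ≤ ρ)
    (hρ : ρ ≤ (1 - δ) / 2) (hSM : 4 * (8 * S) ^ 2 * Real.exp (2 * (8 * S)) ≤ δ * θ)
    (hPext : ∀ p ∈ Pext, (⟨p.src, p.μ⟩ : PBond P j) ∉ Λ ∧ (⟨p.src.shift p.μ, p.ν⟩ : PBond P j) ∉ Λ ∧
      (⟨p.src.shift p.ν, p.μ⟩ : PBond P j) ∉ Λ ∧ (⟨p.src, p.ν⟩ : PBond P j) ∉ Λ) (hdisj : Disjoint Pext Pw) :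
    SlotAntiConcentration
      ((fieldMeasure P j SU2).withDensity fun U =>
        ENNReal.ofReal (Real.exp (-(β * ∑ p ∈ Pext ∪ Pw, (1 - reTr (GaugeField.plaqHol U p))))))
      (wilsonU hPu) θ ρ (2 * ((n : ℝ) + β * ∑ _p ∈ Pw, (8 * S) * (8 + 4 * (8 * S))) / (1 - δ)) := by
  have hw : Measurable fun U : GaugeField P j SU2 =>
      ENNReal.ofReal (Real.exp (-(β * ∑ p ∈ Pext ∪ Pw, (1 - reTr (GaugeField.plaqHol U p))))) :=
    ENNReal.measurable_ofReal.comp (Real.measurable_exp.comp (measurable_const.mul (measurable_wilsonSum _)).neg)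
  have hχ : Measurable fun U : GaugeField P j SU2 => ENNReal.ofReal (smallInd (wilsonU hPu U) θ) :=
    ENNReal.measurable_ofReal.comp (measurable_smallInd (measurable_wilsonU hPu) θ)
  have key := slotAntiConcentration_wilson_su2_gibbs_kept hN hm Λ hΛbox hΛcomb hcov e hS hS8 hSπ hPu hPubox hboxPu Pw
    Pext hβ hθ hrad hδ0 hδ1 hρ0 hρ hSM hPext hdisj
  have hprod : (fun U : GaugeField P j SU2 => ENNReal.ofReal (smallInd (wilsonU hPu U) θ) *
      ENNReal.ofReal (Real.exp (-(β * ∑ p ∈ Pext ∪ Pw, (1 - reTr (GaugeField.plaqHol U p)))))) =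
      (fun U => ENNReal.ofReal (Real.exp (-(β * ∑ p ∈ Pext ∪ Pw, (1 - reTr (GaugeField.plaqHol U p)))))) *
        fun U => ENNReal.ofReal (smallInd (wilsonU hPu U) θ) := by
    funext U; exact mul_comm _ _
  rw [hprod, withDensity_mul _ hw hχ] at key
  exact slotAntiConcentration_of_kept _ (measurable_wilsonU hPu) key

end Gibbs

/-! ## §3 The cube partition as an instance of the histories data (common positive integral) -/

section Cubes

variable {Ω σ : Type*} [MeasurableSpace Ω] [DecidableEq σ]

/-- THE WEIGHT OF THE HISTORY `O ⊆ C` IN THE COMMON-FACTOR MODEL: the common positive integral `μ` times the history's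
own large-field functions, `largeLaw C μ u θ O = (∏_{s∈C∖O} ζ_θ(u_s)) · μ`. [folklore] -/
def largeLaw (C : Finset σ) (μ : Measure Ω) (u : σ → Ω → ℝ) (θ : ℝ) (O : Finset σ) : Measure Ω :=
  μ.withDensity fun ω => ENNReal.ofReal (∏ s ∈ C \ O, largeInd (u s ω) θ)

/-- the large-field product is measurable. [folklore] -/
theorem measurable_largeProd (C O : Finset σ) {u : σ → Ω → ℝ} (hu : ∀ s, Measurable (u s)) (θ : ℝ) :
    Measurable fun ω => ENNReal.ofReal (∏ s ∈ C \ O, largeInd (u s ω) θ) :=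
  ENNReal.measurable_ofReal.comp (Finset.measurable_prod _ fun s _ => measurable_largeInd (hu s) θ)

omit [MeasurableSpace Ω] [DecidableEq σ] in
/-- the large-field product lies in `[0,1]`. [folklore] -/
theorem largeProd_mem (D : Finset σ) (u : σ → Ω → ℝ) (θ : ℝ) (ω : Ω) :
    0 ≤ ∏ s ∈ D, largeInd (u s ω) θ ∧ ∏ s ∈ D, largeInd (u s ω) θ ≤ 1 :=
  ⟨prod_nonneg fun _ _ => largeInd_nonneg _ _, prod_le_one (fun _ _ => largeInd_nonneg _ _) fun _ _ => largeInd_le_one _ _⟩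

/-- a history's weight is a finite measure for a finite common integral. [folklore] -/
theorem isFiniteMeasure_largeLaw (C : Finset σ) (μ : Measure Ω) [IsFiniteMeasure μ] (u : σ → Ω → ℝ) (θ : ℝ)
    (O : Finset σ) : IsFiniteMeasure (largeLaw C μ u θ O) := by
  refine isFiniteMeasure_withDensity (ne_top_of_le_ne_top (measure_ne_top μ Set.univ) ?_)
  rw [← lintegral_one]
  exact lintegral_mono fun ω => ENNReal.ofReal_le_one.2 (largeProd_mem (C \ O) u θ ω).2

/-- **THE HISTORY'S LAW IS ROW S17's TERM DENSITY TIMES `μ`**: `smallProd_O · largeLaw_O = regionDensity_O · μ`.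
[folklore] -/
theorem histLaw_largeLaw (C : Finset σ) (μ : Measure Ω) {u : σ → Ω → ℝ} (hu : ∀ s, Measurable (u s)) (θ : ℝ)
    (O : Finset σ) :
    histLaw (largeLaw C μ u θ O) O u (fun _ => θ) = μ.withDensity fun ω => ENNReal.ofReal (regionDensity C u θ O ω) := by
  have hχ : Measurable fun ω => ENNReal.ofReal (smallProd O u (fun _ => θ) ω) :=
    ENNReal.measurable_ofReal.comp (measurable_smallProd O hu _)
  have hmul : (fun ω => ENNReal.ofReal (regionDensity C u θ O ω)) =
      (fun ω => ENNReal.ofReal (∏ s ∈ C \ O, largeInd (u s ω) θ)) * fun ω => ENNReal.ofReal (smallProd O u (fun _ => θ) ω) := by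
    funext ω
    rw [Pi.mul_apply, ← ENNReal.ofReal_mul (largeProd_mem (C \ O) u θ ω).1, regionDensity, smallProd, mul_comm]
  rw [histLaw, largeLaw, hmul, withDensity_mul _ (measurable_largeProd C O hu θ) hχ]

/-- **THE PARTIAL LAW OF A CUBE RESUMS TO ITS OWN INDICATOR TIMES THE COMMON INTEGRAL**: with histories = regions
`O ⊆ C` (small region `O` itself) and weights `largeLaw`, `partialLaw C.powerset (largeLaw C μ u θ) id u θ s =
χ_θ(u_s) · μ` for every cube `s ∈ C` — the partition of unity of the OTHER cubes summed INSIDE the partial law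
(row S17's `sum_regionDensity_mem`). [folklore] -/
theorem partialLaw_cubes (C : Finset σ) (μ : Measure Ω) {u : σ → Ω → ℝ} (hu : ∀ s, Measurable (u s)) (θ : ℝ)
    {s : σ} (hs : s ∈ C) :
    partialLaw C.powerset (largeLaw C μ u θ) (fun O => O) u (fun _ => θ) s =
      μ.withDensity fun ω => ENNReal.ofReal (smallInd (u s ω) θ) := by
  unfold partialLaw
  simp_rw [histLaw_largeLaw C μ hu θ]
  refine Measure.ext fun E hE => ?_
  rw [Measure.finsetSum_apply, withDensity_apply _ hE]
  simp_rw [withDensity_apply _ hE]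
  rw [← lintegral_finsetSum (C.powerset.filter fun O => s ∈ O)
    (f := fun O ω => ENNReal.ofReal (regionDensity C u θ O ω)) fun O _ => (measurable_regionDensity C hu θ O).ennreal_ofReal]
  refine lintegral_congr fun ω => ?_
  rw [← ENNReal.ofReal_sum_of_nonneg fun O _ => regionDensity_nonneg C u θ O ω, Finset.sum_filter,
    sum_regionDensity_mem C u θ hs ω]

/-- integrating against a history's weight = integrating its large-field product against `μ`. [folklore] -/
theorem integral_largeLaw (C : Finset σ) (μ : Measure Ω) {u : σ → Ω → ℝ} (hu : ∀ s, Measurable (u s)) (θ : ℝ)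
    (O : Finset σ) (g : Ω → ℝ) : ∫ ω, g ω ∂(largeLaw C μ u θ O) = ∫ ω, (∏ s ∈ C \ O, largeInd (u s ω) θ) * g ω ∂μ := by
  rw [largeLaw, integral_withDensity_eq_integral_toReal_smul (measurable_largeProd C O hu θ)
    (Filter.Eventually.of_forall fun _ => ENNReal.ofReal_lt_top)]
  refine integral_congr_ae (Filter.Eventually.of_forall fun ω => ?_)
  show (ENNReal.ofReal (∏ s ∈ C \ O, largeInd (u s ω) θ)).toReal • g ω = _
  rw [ENNReal.toReal_ofReal (largeProd_mem (C \ O) u θ ω).1, smul_eq_mul]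

/-- **THE HISTORIES TERM DATA ARE ROW S17's**: weight `histWeight (largeLaw_O) O u θ = regionWeight C μ u θ O` …
[folklore] -/
theorem histWeight_largeLaw (C : Finset σ) (μ : Measure Ω) {u : σ → Ω → ℝ} (hu : ∀ s, Measurable (u s)) (θ : ℝ)
    (O : Finset σ) : histWeight (largeLaw C μ u θ O) O u (fun _ => θ) = regionWeight C μ u θ O := by
  rw [histWeight, integral_largeLaw C μ hu θ O, regionWeight]
  refine integral_congr_ae (Filter.Eventually.of_forall fun ω => ?_)
  show (∏ s ∈ C \ O, largeInd (u s ω) θ) * smallProd O u (fun _ => θ) ω = regionDensity C u θ O ω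
  rw [regionDensity, smallProd, mul_comm]

/-- … shell part `histShell (largeLaw_O) O u^A u^B θ = regionShell C μ u^A u^B θ O` … [folklore] -/
theorem histShell_largeLaw (C : Finset σ) (μ : Measure Ω) {uA : σ → Ω → ℝ} (huA : ∀ s, Measurable (uA s))
    (uB : σ → Ω → ℝ) (θ : ℝ) (O : Finset σ) :
    histShell (largeLaw C μ uA θ O) O uA uB (fun _ => θ) = regionShell C μ uA uB θ O := by
  rw [histShell, integral_largeLaw C μ huA θ O, regionShell]
  refine integral_congr_ae (Filter.Eventually.of_forall fun ω => ?_)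
  show (∏ s ∈ C \ O, largeInd (uA s ω) θ) * (smallProd O uA (fun _ => θ) ω * (1 - smallProd O uB (fun _ => θ) ω)) =
    regionDensity C uA θ O ω * (1 - ∏ s ∈ O, smallInd (uB s ω) θ)
  rw [regionDensity, smallProd, smallProd]
  ring

/-- … and pieces `histPiece (largeLaw_O) O u^A u^B θ s = regionPiece C μ u^A u^B θ s O`: ONE term family, two
admissible realized laws — row S17's `μ` (stripped) and files 1–2's `χ_s·μ` (kept). [folklore] -/
theorem histPiece_largeLaw (C : Finset σ) (μ : Measure Ω) {uA : σ → Ω → ℝ} (huA : ∀ s, Measurable (uA s))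
    (uB : σ → Ω → ℝ) (θ : ℝ) (s : σ) (O : Finset σ) :
    histPiece (largeLaw C μ uA θ O) O uA uB (fun _ => θ) s = regionPiece C μ uA uB θ s O := by
  unfold ShellMeasureRootCompositionHistories.histPiece ShellMeasureRootCompositionPushCubes.regionPiece
  split_ifs with hsO
  · rw [integral_largeLaw C μ huA θ O]
    refine integral_congr_ae (Filter.Eventually.of_forall fun ω => ?_)
    show (∏ s ∈ C \ O, largeInd (uA s ω) θ) * (smallProd O uA (fun _ => θ) ω * (1 - smallInd (uB s ω) θ)) =
      regionDensity C uA θ O ω * (1 - smallInd (uB s ω) θ)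
    rw [regionDensity, smallProd]
    ring
  · rfl

end Cubes

/-! ## §4 The level-0 histories ledger of the `SU(2)` Gibbs law: (M1)₀ discharged in the kept form -/

section Ledger

variable {P : Params} {j : ℕ} [DecidableEq (PBond P j)] [DecidableEq (Plaq P j)] {σ₀ : Type*} [DecidableEq σ₀]

/-- **THE LEVEL-0 HISTORIES LEDGER OF THE `SU(2)` GIBBS MEASURE ⇐ CLOSENESS + NUMERICS ONLY (no `σ`).**  ONE lattice
`(P, j)`; cubes `s : σ₀` with row S1's per-cube box data (`lo s, hi s, m s, Λ s, e s, n s`, `Pw s`∕`Pext s` splitting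
THE SAME `P_all`), classifier plaquettes `Pu s` = the box plaquettes; cubes present at cutoff `K` a finset `C K`;
histories = regions `O ⊆ C K` with weights `largeLaw (C K) μ u^A θ₀ O` over the Gibbs law `μ = e^{−β Σ_{P_all}} dU`; run
A's tested variable of cube `s` = `wilsonU (Pu s)`, run B's any measurable `u^B K t s`, a.e. `ρ₀θ₀`-close under `μ`;
numerics as §2 (reach condition at `θ₀`); `D_s ≤ D 0`.  CONCLUSION: file 2's `LevelLedger` for the histories data
(`lvl ≡ 0`), THE WALL (M1)₀ DISCHARGED per cube by §2 (kept form, `partialLaw_cubes`, `slotAntiConcentration_mono`); by §3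
its term data are row S17's — row S19 §2's ledger under weaker numerics.  NOT NE7c. [folklore] -/
theorem levelLedger_histories_wilson_su2_levelZero
    (lo hi : σ₀ → Fin P.d → ℤ) (m : σ₀ → ℕ) (hN : ∀ s κ, hi s κ - lo s κ < P.sitesPerDir j)
    (hm : ∀ s κ, hi s κ ≤ lo s κ + m s) (Λ : σ₀ → Finset (PBond P j)) (hΛbox : ∀ s, ∀ b ∈ Λ s, b ∈ boxBonds (lo s) (hi s))
    (hΛcomb : ∀ s, Disjoint (Λ s) (combBonds (lo s) (hi s)))
    (hcov : ∀ s, ∀ b ∈ boxBonds (lo s) (hi s), b ∉ Λ s → b ∈ (combBonds (lo s) (hi s) : Finset (PBond P j)))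
    (n : σ₀ → ℕ) (e : ∀ s, ↥(Λ s) × Fin 3 ≃ Fin (n s)) {S : ℝ} (hS : 0 < S) (hS8 : S ≤ 1 / 8) (hSπ : 3 * S ^ 2 < Real.pi ^ 2)
    (Pu : σ₀ → Finset (Plaq P j)) (hPu : ∀ s, (Pu s).Nonempty) (hPubox : ∀ s, ∀ p ∈ Pu s, p ∈ boxPlaqs (lo s) (hi s))
    (hboxPu : ∀ s, boxPlaqs (lo s) (hi s) ⊆ (↑(Pu s) : Set (Plaq P j)))
    (Pw Pext : σ₀ → Finset (Plaq P j)) (Pall : Finset (Plaq P j)) {β δ : ℝ} {θ ρ D : ℕ → ℝ} (hβ : 0 ≤ β)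
    (hθ : 0 < θ 0) (hrad : ∀ s, ((P.d - 1 : ℕ) : ℝ) * m s * θ 0 ≤ 2 * S / Real.pi) (hδ0 : 0 ≤ δ) (hδ1 : δ < 1)
    (hρ0 : ∀ i, 0 ≤ ρ i) (hρ : ρ 0 ≤ (1 - δ) / 2) (hSM : 4 * (8 * S) ^ 2 * Real.exp (2 * (8 * S)) ≤ δ * θ 0)
    (hPext : ∀ s, ∀ p ∈ Pext s, (⟨p.src, p.μ⟩ : PBond P j) ∉ Λ s ∧ (⟨p.src.shift p.μ, p.ν⟩ : PBond P j) ∉ Λ s ∧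
      (⟨p.src.shift p.ν, p.μ⟩ : PBond P j) ∉ Λ s ∧ (⟨p.src, p.ν⟩ : PBond P j) ∉ Λ s)
    (hdisj : ∀ s, Disjoint (Pext s) (Pw s)) (hall : ∀ s, Pext s ∪ Pw s = Pall) (hD0 : ∀ i, 0 ≤ D i)
    (hD : ∀ s, 2 * ((n s : ℝ) + β * ∑ _p ∈ Pw s, (8 * S) * (8 + 4 * (8 * S))) / (1 - δ) ≤ D 0)
    -- the run's cubes per cutoff, the other run's tested variables, the closeness (node U1b at level 0)
    (C : ℕ → Finset σ₀) {l₀ : ℝ} (uB : ℕ → ℝ → σ₀ → GaugeField P j SU2 → ℝ) (huB : ∀ K t s, Measurable (uB K t s))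
    (hclose : ∀ K t, |t| ≤ l₀ → ∀ s ∈ C K,
      ∀ᵐ U ∂((fieldMeasure P j SU2).withDensity fun U =>
        ENNReal.ofReal (Real.exp (-(β * ∑ p ∈ Pall, (1 - reTr (GaugeField.plaqHol U p)))))),
        |wilsonU (hPu s) U - uB K t s U| ≤ ρ 0 * θ 0) :
    LevelLedger l₀ (fun K => (C K).powerset)
      (fun K (_ : ℝ) O => histWeight (largeLaw (C K)
        ((fieldMeasure P j SU2).withDensity fun U =>
          ENNReal.ofReal (Real.exp (-(β * ∑ p ∈ Pall, (1 - reTr (GaugeField.plaqHol U p))))))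
        (fun s => wilsonU (hPu s)) (θ 0) O) O (fun s => wilsonU (hPu s)) (fun _ => θ 0))
      (fun K t O => histShell (largeLaw (C K)
        ((fieldMeasure P j SU2).withDensity fun U =>
          ENNReal.ofReal (Real.exp (-(β * ∑ p ∈ Pall, (1 - reTr (GaugeField.plaqHol U p))))))
        (fun s => wilsonU (hPu s)) (θ 0) O) O (fun s => wilsonU (hPu s)) (uB K t) (fun _ => θ 0))
      C
      (fun K t s O => histPiece (largeLaw (C K)
        ((fieldMeasure P j SU2).withDensity fun U =>
          ENNReal.ofReal (Real.exp (-(β * ∑ p ∈ Pall, (1 - reTr (GaugeField.plaqHol U p))))))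
        (fun s => wilsonU (hPu s)) (θ 0) O) O (fun s => wilsonU (hPu s)) (uB K t) (fun _ => θ 0) s)
      (fun _ _ => 0) D ρ := by
  -- abbreviate the Gibbs law
  set μG : Measure (GaugeField P j SU2) := (fieldMeasure P j SU2).withDensity fun U =>
    ENNReal.ofReal (Real.exp (-(β * ∑ p ∈ Pall, (1 - reTr (GaugeField.plaqHol U p))))) with hμG
  -- it is finite (density ≤ 1 against the product Haar probability)
  haveI hfin : IsFiniteMeasure μG := by
    refine isFiniteMeasure_withDensity (ne_top_of_le_ne_top (measure_ne_top (fieldMeasure P j SU2) Set.univ) ?_)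
    rw [← lintegral_one]
    exact lintegral_mono fun U => by
      rw [ENNReal.ofReal_le_one, Real.exp_le_one_iff, neg_nonpos]; exact mul_nonneg hβ (wilsonSum_nonneg Pall U)
  have huA : ∀ s, Measurable fun U : GaugeField P j SU2 => wilsonU (hPu s) U := fun s => measurable_wilsonU (hPu s)
  have hw : Measurable fun U : GaugeField P j SU2 =>
      ENNReal.ofReal (Real.exp (-(β * ∑ p ∈ Pall, (1 - reTr (GaugeField.plaqHol U p))))) :=
    ENNReal.measurable_ofReal.comp (Real.measurable_exp.comp (measurable_const.mul (measurable_wilsonSum _)).neg)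
  -- (M1)₀ per cube in the KEPT form, for the partial law, raised to the uniform constant `D 0`
  have hac : ∀ (K : ℕ) (t : ℝ), |t| ≤ l₀ → ∀ s ∈ C K, SlotAntiConcentration
      (partialLaw (C K).powerset (largeLaw (C K) μG (fun s => wilsonU (hPu s)) (θ 0)) (fun O => O)
        (fun s => wilsonU (hPu s)) (fun _ => θ 0) s) (wilsonU (hPu s)) (θ 0) (ρ 0) (D 0) := by
    intro K t _ s hs
    rw [partialLaw_cubes (C K) μG huA (θ 0) hs]
    have key := slotAntiConcentration_wilson_su2_gibbs_kept (hN s) (hm s) (Λ s) (hΛbox s) (hΛcomb s) (hcov s) (e s)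
      hS hS8 hSπ (hPu s) (hPubox s) (hboxPu s) (Pw s) (Pext s) hβ hθ (hrad s) hδ0 hδ1 (hρ0 0) hρ hSM (hPext s)
      (hdisj s)
    rw [hall s] at key
    have hχ : Measurable fun U : GaugeField P j SU2 => ENNReal.ofReal (smallInd (wilsonU (hPu s) U) (θ 0)) :=
      ENNReal.measurable_ofReal.comp (measurable_smallInd (huA s) (θ 0))
    have hprod : (fun U : GaugeField P j SU2 => ENNReal.ofReal (smallInd (wilsonU (hPu s) U) (θ 0)) *
        ENNReal.ofReal (Real.exp (-(β * ∑ p ∈ Pall, (1 - reTr (GaugeField.plaqHol U p)))))) =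
        (fun U => ENNReal.ofReal (Real.exp (-(β * ∑ p ∈ Pall, (1 - reTr (GaugeField.plaqHol U p)))))) *
          fun U => ENNReal.ofReal (smallInd (wilsonU (hPu s) U) (θ 0)) := by
      funext U; exact mul_comm _ _
    rw [hprod, withDensity_mul _ hw hχ, ← hμG] at key
    exact T4ShellMeasureFibre.slotAntiConcentration_mono (hρ0 0) (hD s) key
  -- closeness under every history's weight (absolutely continuous w.r.t. the Gibbs law)
  have hclose' : ∀ (K : ℕ) (t : ℝ), |t| ≤ l₀ → ∀ O ∈ (C K).powerset, ∀ s ∈ O,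
      ∀ᵐ U ∂(largeLaw (C K) μG (fun s => wilsonU (hPu s)) (θ 0) O), |wilsonU (hPu s) U - uB K t s U| ≤ ρ 0 * θ 0 :=
    fun K t ht O hO s hs => (withDensity_absolutelyContinuous μG _).ae_le
      (hclose K t ht s (Finset.mem_powerset.1 hO hs))
  have hinst : ∀ (K : ℕ) (t : ℝ) (O : Finset σ₀),
      IsFiniteMeasure ((fun (K : ℕ) (_ : ℝ) (O : Finset σ₀) =>
        largeLaw (C K) μG (fun s => wilsonU (hPu s)) (θ 0) O) K t O) :=
    fun K _ O => isFiniteMeasure_largeLaw _ _ _ _ _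
  exact @levelLedger_histories (fun _ => GaugeField P j SU2) _ σ₀ (Finset σ₀) _ (fun K => (C K).powerset) C
    (fun _ O => O) (fun _ _ => 0) (fun K _ O => largeLaw (C K) μG (fun s => wilsonU (hPu s)) (θ 0) O) hinst
    (fun _ _ s => wilsonU (hPu s)) uB θ ρ D l₀ (fun _ _ s => huA s) huB (fun K O hO => Finset.mem_powerset.1 hO)
    hclose' hD0 hρ0 hac

end Ledger

end Summit.QuantumFields.BalabanUV.T4Continuum.ShellMeasureRootCompositionHistoriesLevelZero

end
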